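import Literature.NumberTheory.ComplexMultiplication.CMOrderCohenMacaulayTypeGlobal
import HarnessLib

/-!
# Type and numbers of generators: `gens_S((𝔭:𝔭)) = type_𝔭(S) + 1` at a non-invertible prime (MARSEGLIA 2024,
# equation (4.3) in the proof of THEOREM 4.7 = MAIN THEOREM 2), `gens(S)` (DEFINITION 4.1), and
# `type(S) + 1 = max_𝔭 gens_S((𝔭:𝔭)) ≤ gens(S)` for a non-maximal order (THEOREM 4.7, (i) versus (v), the case `T = S`)

Family `hodge`, lane `lit-hodgefound` (Track 2 foundations library; seat p15, row g28-#5), topic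
`Literature/NumberTheory/ComplexMultiplication`, namespace `Literature.NumberTheory.ComplexMultiplication.CMTypeLattice`
(the order `𝔯 = endOrder (M_μ)` of a `ℚ`-basis `μ` of a number field `K` of degree `#ι = [K:ℚ]`; `gens_𝔯(I)` is
Mathlib's `Submodule.spanFinrank` of `↑I` (`CMOrderIdealGeneratorsCount`, LEMMA 4.2); the local type
`type_𝔭(𝔯) = finrank (𝔯 ⧸ 𝔭) (↥↑T ⧸ 𝔭 • ⊤)` with `↑T = traceDual ℤ ℚ ↑1` and the global type
`type(𝔯) = ⨆ 𝔭 : MaximalSpectrum 𝔯, type_𝔭(𝔯)` (`CMOrderCohenMacaulayTypeOne`, `CMOrderCohenMacaulayTypeGlobal`); the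
multiplicator ring `(𝔭:𝔭) = ↑𝔭/↑𝔭`, the `𝔯/𝔭`-space `(𝔭:𝔭)/𝔭 = (𝔭:𝔭)/𝔭(𝔭:𝔭) = ↥↑(↑𝔭/↑𝔭) ⧸ 𝔭 • ⊤`
(`CMOrderCohenMacaulayTypeBound`); `R_𝔮 = Localization.subalgebra.ofField K 𝔮.primeCompl _`, `I_𝔮 = span R_𝔮 ↑I`).
THEOREMS ONLY: no definition, no instance, no named fact (net Literature debt `0`).  SCOPE: THEOREM 4.7 compares
`S` with ALL its over-orders `T` as base rings; the tree's vocabulary has one base order `𝔯` at a time, so this file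
proves the printed chain `type(T) + 1 = max_𝔭 gens_T((𝔭:𝔭)) ≤ gens(T)` for `T = 𝔯` itself (which is the content of
equation (4.3) and of COROLLARY 3.6), and DEFINITION 4.1's `gens(𝔯)`; the comparison over the family of over-orders
(and LEMMA 4.3 [Greither82], PROP. 4.5) is NOT formalised here.

## Source, VERBATIM

S. Marseglia, *Cohen-Macaulay type of orders, generators and ideal classes*, J. Algebra 658 (2024) 247–276
[Marseglia2024CMType] (arXiv:2206.03758, held `paper:arxiv-2206.03758`), §4, chunk p0010: "Definition 4.1. For an
order `S`, put `gens(S) = max{gens_S(I) : I is a fractional S-ideal}`." and chunk p0011: "Theorem 4.7. Let `S` be a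
non-maximal order, `𝒮` be the set of overorders `T` of `S`, and `d` be a positive integer. Then the following are
equivalent: (i) `1 + max_{T ∈ 𝒮} type(T) = d`. (ii) `max_{T ∈ 𝒮} max{dim_{T/𝔭} ((𝔭:𝔭)/𝔭) : 𝔭 a prime of T} = d`.
(iii) `gens_S(𝒪_K/S) = d − 1`. (iv) `max_{T ∈ 𝒮} max{dim_{T/𝔓} (𝒪_K/𝔓𝒪_K) : 𝔓 a prime of T} = d`.
(v) `max_{T ∈ 𝒮} gens(T) = d`. (vi) `g(S) = d`.  Proof. Let `T` be a non-maximal overorder in `𝒮`. Then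
`type(T) + 1 = max{dim_{T/𝔭} (𝔭:𝔭)/𝔭 : 𝔭 a prime of T}`, by Corollary 3.6. […] For the other direction, pick any
non-maximal `T ∈ 𝒮` and let `𝔭` be prime of `T`. We claim that `dim_{T/𝔭} (𝔭:𝔭)/𝔭 = gens_T((𝔭:𝔭))` (4.3).
Indeed, if `𝔭` is invertible then by Lemma 2.x we have that `T = (𝔭:𝔭)`. On the other hand, if `𝔭` is not
invertible then `(𝔭:𝔭)` is a non-principal fractional `T`-ideal. Hence Equation (4.3) follows from Lemma 4.2. Now,
combining Equation (4.3) and Corollary 3.6, we see `type(T) + 1 = max{gens_T((𝔭:𝔭)) : 𝔭 a prime of T}` which is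
bounded from above by `gens(T)`. As we already observed before, we have `gens(T) ≤ gens(S)`, which gives us
`type(T) + 1 ≤ gens(S)`, as required to complete the proof."

## What is formalised (the printed proof, step by step, for `T = 𝔯`)

* §1 «`(𝔭:𝔭)_𝔮 = 𝔯_𝔮` away from `𝔭`» (`span_coe_coeIdeal_div_self_eq_span_one_of_not_le`,
  `finrank_div_self_quotient_eq_one_of_not_le`); **equation (4.3) at a non-invertible prime,
  `spanFinrank_coe_div_self_eq_finrank_traceDual_quotient_add_one`: `gens_𝔯((𝔭:𝔭)) = type_𝔭(𝔯) + 1`** (LEMMA 4.2 with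
  `m = type_𝔭 + 1 ≥ 2`: the local dimensions of `(𝔭:𝔭)` are `type_𝔭 + 1` at `𝔭`, PROP. 3.5, and `1` elsewhere);
  «if `𝔭` is invertible then `T = (𝔭:𝔭)`», `gens = 1` (`spanFinrank_coe_div_self_eq_one_of_isUnit`); **(4.3) at every
  prime, `spanFinrank_coe_div_self_eq_finrank_div_self_quotient`**; «`(𝔭:𝔭)` is a non-principal fractional ideal»
  (`not_isPrincipal_coe_div_self_of_not_isUnit`).
* §2 **`iSup_finrank_traceDual_quotient_add_one_eq_iSup_spanFinrank`: `type(𝔯) + 1 = max_𝔭 gens_𝔯((𝔭:𝔭))` for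
  `𝔯 ≠ 𝒪_K`** (COROLLARY 3.6 of `CMOrderCohenMacaulayTypeGlobal` and (4.3)).
* §3 DEFINITION 4.1: `gens(𝔯) = ⨆_{I ≠ 0} gens_𝔯(I)` is bounded by `[K:ℚ]` (`bddAbove_range_spanFinrank_coe`,
  `iSup_spanFinrank_coe_le_card`, `spanFinrank_coe_le_iSup`); **THEOREM 4.7 ((i) versus (v)) for `T = 𝔯`:
  `iSup_finrank_traceDual_quotient_add_one_le_iSup_spanFinrank`, `type(𝔯) + 1 ≤ gens(𝔯)`** when `𝔯 ≠ 𝒪_K`, hence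
  `2 ≤ gens(𝔯)` (`two_le_iSup_spanFinrank`).
-/

noncomputable section

open scoped nonZeroDivisors NumberField
open NumberField Module FractionalIdeal
open Submodule (traceDual)

namespace Literature.NumberTheory.ComplexMultiplication

namespace CMTypeLattice

variable {K : Type} [Field K] [NumberField K]
variable {ι : Type} [Fintype ι] [DecidableEq ι] (μ : Basis ι ℚ K) [Nonempty ι]
variable [IsFractionRing (endOrder (Algebra.leftMulMatrix μ)) K]

/-! ## §1 Equation (4.3): `gens_𝔯((𝔭:𝔭)) = dim_{𝔯/𝔭} (𝔭:𝔭)/𝔭 = type_𝔭(𝔯) + 1` at a non-invertible prime -/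

/-- **«`(𝔭:𝔭)_𝔮 = 𝔯_𝔮` at a prime `𝔮 ⊉ 𝔭`**: the multiplicator ring of `𝔭` is trivial away from `𝔭` (`𝔭_𝔮 = 𝔯_𝔮`, so
`(𝔭:𝔭)_𝔮 = (𝔯:𝔯)_𝔮 = 𝔯_𝔮`). [cite: Marseglia2024CMType, §2.5 Lemma 2.10 (ii) («`(I:J)_𝔭 = (I_𝔭:J_𝔭)`»), p. 6;
§4 Thm. 4.7 (proof, eq. (4.3)), p. 11] -/
theorem span_coe_coeIdeal_div_self_eq_span_one_of_not_le {𝔭 𝔮 : Ideal (endOrder (Algebra.leftMulMatrix μ))}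
    [𝔮.IsPrime] (h0 : 𝔭 ≠ ⊥) (h : ¬ 𝔭 ≤ 𝔮) :
    Submodule.span (Localization.subalgebra.ofField K 𝔮.primeCompl 𝔮.primeCompl_le_nonZeroDivisors)
        ((((𝔭 : FractionalIdeal (endOrder (Algebra.leftMulMatrix μ))⁰ K) / 𝔭 :
          FractionalIdeal (endOrder (Algebra.leftMulMatrix μ))⁰ K) : Set K)) =
      Submodule.span (Localization.subalgebra.ofField K 𝔮.primeCompl 𝔮.primeCompl_le_nonZeroDivisors) {1} := by
  haveI := isNoetherianRing_endOrder (Algebra.leftMulMatrix μ)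
  have hP0 : (𝔭 : FractionalIdeal (endOrder (Algebra.leftMulMatrix μ))⁰ K) ≠ 0 := coeIdeal_ne_zero.2 h0
  have h1 : Submodule.span (Localization.subalgebra.ofField K 𝔮.primeCompl 𝔮.primeCompl_le_nonZeroDivisors)
        ((𝔭 : FractionalIdeal (endOrder (Algebra.leftMulMatrix μ))⁰ K) : Set K) =
      Submodule.span (Localization.subalgebra.ofField K 𝔮.primeCompl 𝔮.primeCompl_le_nonZeroDivisors) {1} *
        Submodule.span (Localization.subalgebra.ofField K 𝔮.primeCompl 𝔮.primeCompl_le_nonZeroDivisors)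
          ((1 : FractionalIdeal (endOrder (Algebra.leftMulMatrix μ))⁰ K) : Set K) := by
    rw [NumberRing.span_coeIdeal_eq_span_one_of_not_le h, NumberRing.span_coe_one, Submodule.span_mul_span,
      Set.singleton_mul_singleton, mul_one]
  have h2 := NumberRing.span_coe_div_self_eq_of_span_coe_eq hP0 one_ne_zero 𝔮 h1
  rwa [FractionalIdeal.div_one, NumberRing.span_coe_one] at h2

/-- **`dim_{𝔯/𝔮} (𝔭:𝔭)/𝔮(𝔭:𝔭) = 1` at every prime `𝔮 ≠ 0` not containing `𝔭`** (the over-order `(𝔭:𝔭) = (𝔭:𝔭)(𝔭:𝔭)`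
is locally trivial there, LEMMA 2.14 (i) (b)⟺(c)). [cite: Marseglia2024CMType, §2.5 Lemma 2.14 (i), p. 7; §4 Thm. 4.7
(proof, eq. (4.3)), p. 11] -/
theorem finrank_div_self_quotient_eq_one_of_not_le {𝔭 𝔮 : Ideal (endOrder (Algebra.leftMulMatrix μ))}
    [𝔮.IsPrime] (hq0 : 𝔮 ≠ ⊥) (h0 : 𝔭 ≠ ⊥) (h : ¬ 𝔭 ≤ 𝔮) :
    Module.finrank (endOrder (Algebra.leftMulMatrix μ) ⧸ 𝔮)
      ((((𝔭 : FractionalIdeal (endOrder (Algebra.leftMulMatrix μ))⁰ K) / 𝔭 :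
        FractionalIdeal (endOrder (Algebra.leftMulMatrix μ))⁰ K) : Submodule (endOrder (Algebra.leftMulMatrix μ)) K) ⧸
        (𝔮 • ⊤ : Submodule (endOrder (Algebra.leftMulMatrix μ))
          (((𝔭 : FractionalIdeal (endOrder (Algebra.leftMulMatrix μ))⁰ K) / 𝔭 :
            FractionalIdeal (endOrder (Algebra.leftMulMatrix μ))⁰ K) : Submodule (endOrder (Algebra.leftMulMatrix μ)) K))) =
      1 := by
  have hP0 : (𝔭 : FractionalIdeal (endOrder (Algebra.leftMulMatrix μ))⁰ K) ≠ 0 := coeIdeal_ne_zero.2 h0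
  exact (EndOrder.finrank_quotient_eq_one_iff_span_coe_eq_span_one (EndOrder.div_self_mul_div_self hP0)
    (EndOrder.div_self_ne_zero hP0) hq0).2 (span_coe_coeIdeal_div_self_eq_span_one_of_not_le μ h0 h)

/-- **MARSEGLIA 2024, equation (4.3) at a NON-INVERTIBLE prime: `gens_𝔯((𝔭:𝔭)) = type_𝔭(𝔯) + 1`** — «if `𝔭` is not
invertible then `(𝔭:𝔭)` is a non-principal fractional ideal. Hence (4.3) follows from Lemma 4.2»: the local dimensions
of `(𝔭:𝔭)` are `type_𝔭 + 1 ≥ 2` at `𝔭` (PROP. 3.5) and `1` at every other prime, so LEMMA 4.2 gives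
`gens = max = type_𝔭 + 1`. [cite: Marseglia2024CMType, §4 Thm. 4.7 (proof, eq. (4.3)), p. 11; §4 Lemma 4.2, p. 10; §3
Prop. 3.5, p. 9] -/
theorem spanFinrank_coe_div_self_eq_finrank_traceDual_quotient_add_one
    {T : FractionalIdeal (endOrder (Algebra.leftMulMatrix μ))⁰ K}
    (hT : (T : Submodule (endOrder (Algebra.leftMulMatrix μ)) K) =
      traceDual ℤ ℚ ((1 : FractionalIdeal (endOrder (Algebra.leftMulMatrix μ))⁰ K) :
        Submodule (endOrder (Algebra.leftMulMatrix μ)) K))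
    (𝔭 : Ideal (endOrder (Algebra.leftMulMatrix μ))) [h𝔭 : 𝔭.IsMaximal]
    (hu : ¬ IsUnit (𝔭 : FractionalIdeal (endOrder (Algebra.leftMulMatrix μ))⁰ K)) :
    ((((𝔭 : FractionalIdeal (endOrder (Algebra.leftMulMatrix μ))⁰ K) / 𝔭 :
        FractionalIdeal (endOrder (Algebra.leftMulMatrix μ))⁰ K) : Submodule (endOrder (Algebra.leftMulMatrix μ)) K)).spanFinrank =
      Module.finrank (endOrder (Algebra.leftMulMatrix μ) ⧸ 𝔭)
        ((T : Submodule (endOrder (Algebra.leftMulMatrix μ)) K) ⧸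
          (𝔭 • ⊤ : Submodule (endOrder (Algebra.leftMulMatrix μ))
            (T : Submodule (endOrder (Algebra.leftMulMatrix μ)) K))) + 1 := by
  have h0 : 𝔭 ≠ ⊥ := Ring.ne_bot_of_isMaximal_of_not_isField h𝔭 EndOrder.not_isField
  have hP0 : (𝔭 : FractionalIdeal (endOrder (Algebra.leftMulMatrix μ))⁰ K) ≠ 0 := coeIdeal_ne_zero.2 h0
  have h35 := finrank_traceDual_quotient_add_one_eq μ hT 𝔭 hu
  refine EndOrder.spanFinrank_eq_of_forall_finrank_quotient_le (EndOrder.div_self_ne_zero hP0)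
    (Nat.succ_le_succ (Nat.one_le_iff_ne_zero.2 (finrank_traceDual_quotient_pos μ hT h0).ne')) (fun 𝔮 ↦ ?_)
    ⟨⟨𝔭, h𝔭⟩, h35.symm⟩
  -- at `𝔮 = 𝔭` the dimension is `type_𝔭 + 1`; at `𝔮 ≠ 𝔭` it is `1`
  by_cases hle : 𝔭 ≤ 𝔮.asIdeal
  · have heq : 𝔮 = ⟨𝔭, h𝔭⟩ := MaximalSpectrum.ext (h𝔭.eq_of_le 𝔮.isMaximal.ne_top hle).symm
    subst heq
    exact h35.symm.le
  · rw [finrank_div_self_quotient_eq_one_of_not_le μ (asIdeal_ne_bot μ 𝔮) h0 hle]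
    exact Nat.le_add_left 1 _

omit [Nonempty ι] in
/-- **Equation (4.3) at an INVERTIBLE prime: «by Lemma 2.x we have that `T = (𝔭:𝔭)`», so `gens_𝔯((𝔭:𝔭)) = gens_𝔯(𝔯) = 1`.**
[cite: Marseglia2024CMType, §4 Thm. 4.7 (proof, eq. (4.3)), p. 11; §2.5 (multiplicator ring of an invertible ideal),
p. 7] -/
theorem spanFinrank_coe_div_self_eq_one_of_isUnit {𝔭 : Ideal (endOrder (Algebra.leftMulMatrix μ))}
    (hu : IsUnit (𝔭 : FractionalIdeal (endOrder (Algebra.leftMulMatrix μ))⁰ K)) :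
    ((((𝔭 : FractionalIdeal (endOrder (Algebra.leftMulMatrix μ))⁰ K) / 𝔭 :
        FractionalIdeal (endOrder (Algebra.leftMulMatrix μ))⁰ K) : Submodule (endOrder (Algebra.leftMulMatrix μ)) K)).spanFinrank =
      1 := by
  rw [EndOrder.fractionalIdeal_div_self_of_isUnit hu, FractionalIdeal.coe_one, Submodule.one_eq_span]
  exact Submodule.spanFinrank_singleton one_ne_zero

/-- **MARSEGLIA 2024, equation (4.3) at every prime `𝔭 ≠ 0`: `gens_𝔯((𝔭:𝔭)) = dim_{𝔯/𝔭} (𝔭:𝔭)/𝔭`** («We claim that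
`dim_{T/𝔭} (𝔭:𝔭)/𝔭 = gens_T((𝔭:𝔭))`»: both are `1` at an invertible prime, both are `type_𝔭 + 1` at a non-invertible
one). [cite: Marseglia2024CMType, §4 Thm. 4.7 (proof, eq. (4.3)), p. 11] -/
theorem spanFinrank_coe_div_self_eq_finrank_div_self_quotient
    {T : FractionalIdeal (endOrder (Algebra.leftMulMatrix μ))⁰ K}
    (hT : (T : Submodule (endOrder (Algebra.leftMulMatrix μ)) K) =
      traceDual ℤ ℚ ((1 : FractionalIdeal (endOrder (Algebra.leftMulMatrix μ))⁰ K) :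
        Submodule (endOrder (Algebra.leftMulMatrix μ)) K))
    {𝔭 : Ideal (endOrder (Algebra.leftMulMatrix μ))} [h𝔭 : 𝔭.IsPrime] (h0 : 𝔭 ≠ ⊥) :
    ((((𝔭 : FractionalIdeal (endOrder (Algebra.leftMulMatrix μ))⁰ K) / 𝔭 :
        FractionalIdeal (endOrder (Algebra.leftMulMatrix μ))⁰ K) : Submodule (endOrder (Algebra.leftMulMatrix μ)) K)).spanFinrank =
      Module.finrank (endOrder (Algebra.leftMulMatrix μ) ⧸ 𝔭)
        ((((𝔭 : FractionalIdeal (endOrder (Algebra.leftMulMatrix μ))⁰ K) / 𝔭 :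
          FractionalIdeal (endOrder (Algebra.leftMulMatrix μ))⁰ K) : Submodule (endOrder (Algebra.leftMulMatrix μ)) K) ⧸
          (𝔭 • ⊤ : Submodule (endOrder (Algebra.leftMulMatrix μ))
            (((𝔭 : FractionalIdeal (endOrder (Algebra.leftMulMatrix μ))⁰ K) / 𝔭 :
              FractionalIdeal (endOrder (Algebra.leftMulMatrix μ))⁰ K) :
                Submodule (endOrder (Algebra.leftMulMatrix μ)) K))) := by
  haveI := isMaximal_of_isPrime_endOrder (Algebra.leftMulMatrix μ) h𝔭 h0
  by_cases hu : IsUnit (𝔭 : FractionalIdeal (endOrder (Algebra.leftMulMatrix μ))⁰ K)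
  · rw [spanFinrank_coe_div_self_eq_one_of_isUnit μ hu, finrank_div_self_quotient_eq_one_of_isUnit_coeIdeal μ h0 hu]
  · rw [spanFinrank_coe_div_self_eq_finrank_traceDual_quotient_add_one μ hT 𝔭 hu,
      finrank_traceDual_quotient_add_one_eq μ hT 𝔭 hu]

/-- **«If `𝔭` is not invertible then `(𝔭:𝔭)` is a non-principal fractional ideal»** (it needs `type_𝔭 + 1 ≥ 2`
generators). [cite: Marseglia2024CMType, §4 Thm. 4.7 (proof), p. 11] -/
theorem not_isPrincipal_coe_div_self_of_not_isUnit {T : FractionalIdeal (endOrder (Algebra.leftMulMatrix μ))⁰ K}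
    (hT : (T : Submodule (endOrder (Algebra.leftMulMatrix μ)) K) =
      traceDual ℤ ℚ ((1 : FractionalIdeal (endOrder (Algebra.leftMulMatrix μ))⁰ K) :
        Submodule (endOrder (Algebra.leftMulMatrix μ)) K))
    (𝔭 : Ideal (endOrder (Algebra.leftMulMatrix μ))) [h𝔭 : 𝔭.IsMaximal]
    (hu : ¬ IsUnit (𝔭 : FractionalIdeal (endOrder (Algebra.leftMulMatrix μ))⁰ K)) :
    ¬ ((((𝔭 : FractionalIdeal (endOrder (Algebra.leftMulMatrix μ))⁰ K) / 𝔭 :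
        FractionalIdeal (endOrder (Algebra.leftMulMatrix μ))⁰ K) : Submodule (endOrder (Algebra.leftMulMatrix μ)) K)).IsPrincipal := by
  intro hpr
  have h0 : 𝔭 ≠ ⊥ := Ring.ne_bot_of_isMaximal_of_not_isField h𝔭 EndOrder.not_isField
  have hne : ((((𝔭 : FractionalIdeal (endOrder (Algebra.leftMulMatrix μ))⁰ K) / 𝔭 :
      FractionalIdeal (endOrder (Algebra.leftMulMatrix μ))⁰ K) : Submodule (endOrder (Algebra.leftMulMatrix μ)) K)) ≠ ⊥ :=
    fun h ↦ EndOrder.div_self_ne_zero (coeIdeal_ne_zero.2 h0) (coeToSubmodule_eq_bot.1 h)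
  have h1 := (Submodule.spanFinrank_eq_one_iff _).2 ⟨hpr, hne⟩
  rw [spanFinrank_coe_div_self_eq_finrank_traceDual_quotient_add_one μ hT 𝔭 hu] at h1
  have hpos := finrank_traceDual_quotient_pos μ hT h0
  omega

/-! ## §2 `type(𝔯) + 1 = max_𝔭 gens_𝔯((𝔭:𝔭))` for a non-maximal order (COROLLARY 3.6 and (4.3)) -/

/-- The numbers of generators `gens_𝔯((𝔭:𝔭))` are bounded (by `[K:ℚ]`), so their `max_𝔭` is a maximum.
[cite: Marseglia2024CMType, §4 Thm. 4.7 (proof: «`max{gens_T((𝔭:𝔭)) : 𝔭 a prime of T}`»), p. 11; §2.2, p. 5] -/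
theorem bddAbove_range_spanFinrank_coe_div_self :
    BddAbove (Set.range fun 𝔭 : MaximalSpectrum (endOrder (Algebra.leftMulMatrix μ)) ↦
      ((((𝔭.asIdeal : FractionalIdeal (endOrder (Algebra.leftMulMatrix μ))⁰ K) / 𝔭.asIdeal :
        FractionalIdeal (endOrder (Algebra.leftMulMatrix μ))⁰ K) :
          Submodule (endOrder (Algebra.leftMulMatrix μ)) K)).spanFinrank) := by
  refine ⟨Fintype.card ι, ?_⟩
  rintro _ ⟨𝔭, rfl⟩
  exact spanFinrank_coe_le_card μ (EndOrder.div_self_ne_zero (coeIdeal_ne_zero.2 (asIdeal_ne_bot μ 𝔭)))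

/-- `max_𝔭 gens_𝔯((𝔭:𝔭)) = max_𝔭 dim_{𝔯/𝔭} (𝔭:𝔭)/𝔭` (equation (4.3) prime by prime).
[cite: Marseglia2024CMType, §4 Thm. 4.7 (proof, eq. (4.3)), p. 11] -/
theorem iSup_spanFinrank_coe_div_self_eq_iSup_finrank_div_self_quotient
    {T : FractionalIdeal (endOrder (Algebra.leftMulMatrix μ))⁰ K}
    (hT : (T : Submodule (endOrder (Algebra.leftMulMatrix μ)) K) =
      traceDual ℤ ℚ ((1 : FractionalIdeal (endOrder (Algebra.leftMulMatrix μ))⁰ K) :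
        Submodule (endOrder (Algebra.leftMulMatrix μ)) K)) :
    ⨆ 𝔭 : MaximalSpectrum (endOrder (Algebra.leftMulMatrix μ)),
        ((((𝔭.asIdeal : FractionalIdeal (endOrder (Algebra.leftMulMatrix μ))⁰ K) / 𝔭.asIdeal :
          FractionalIdeal (endOrder (Algebra.leftMulMatrix μ))⁰ K) :
            Submodule (endOrder (Algebra.leftMulMatrix μ)) K)).spanFinrank =
      ⨆ 𝔭 : MaximalSpectrum (endOrder (Algebra.leftMulMatrix μ)),
        Module.finrank (endOrder (Algebra.leftMulMatrix μ) ⧸ 𝔭.asIdeal)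
          ((((𝔭.asIdeal : FractionalIdeal (endOrder (Algebra.leftMulMatrix μ))⁰ K) / 𝔭.asIdeal :
            FractionalIdeal (endOrder (Algebra.leftMulMatrix μ))⁰ K) : Submodule (endOrder (Algebra.leftMulMatrix μ)) K) ⧸
            (𝔭.asIdeal • ⊤ : Submodule (endOrder (Algebra.leftMulMatrix μ))
              (((𝔭.asIdeal : FractionalIdeal (endOrder (Algebra.leftMulMatrix μ))⁰ K) / 𝔭.asIdeal :
                FractionalIdeal (endOrder (Algebra.leftMulMatrix μ))⁰ K) :
                  Submodule (endOrder (Algebra.leftMulMatrix μ)) K))) :=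
  iSup_congr fun 𝔭 ↦ spanFinrank_coe_div_self_eq_finrank_div_self_quotient μ hT (asIdeal_ne_bot μ 𝔭)

/-- **MARSEGLIA 2024 THEOREM 4.7 (proof): «`type(T) + 1 = max{gens_T((𝔭:𝔭)) : 𝔭 a prime of T}`» for a NON-MAXIMAL
order, here `T = 𝔯 ≠ 𝒪_K`** (COROLLARY 3.6 combined with equation (4.3)). [cite: Marseglia2024CMType, §4 Thm. 4.7
(proof), p. 11; §3 Cor. 3.6, p. 9] -/
theorem iSup_finrank_traceDual_quotient_add_one_eq_iSup_spanFinrank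
    {T : FractionalIdeal (endOrder (Algebra.leftMulMatrix μ))⁰ K}
    (hT : (T : Submodule (endOrder (Algebra.leftMulMatrix μ)) K) =
      traceDual ℤ ℚ ((1 : FractionalIdeal (endOrder (Algebra.leftMulMatrix μ))⁰ K) :
        Submodule (endOrder (Algebra.leftMulMatrix μ)) K))
    (hS : ∃ a : 𝓞 K, (a : K) ∉ endOrder (Algebra.leftMulMatrix μ)) :
    (⨆ 𝔭 : MaximalSpectrum (endOrder (Algebra.leftMulMatrix μ)),
        Module.finrank (endOrder (Algebra.leftMulMatrix μ) ⧸ 𝔭.asIdeal)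
          ((T : Submodule (endOrder (Algebra.leftMulMatrix μ)) K) ⧸
            (𝔭.asIdeal • ⊤ : Submodule (endOrder (Algebra.leftMulMatrix μ))
              (T : Submodule (endOrder (Algebra.leftMulMatrix μ)) K)))) + 1 =
      ⨆ 𝔭 : MaximalSpectrum (endOrder (Algebra.leftMulMatrix μ)),
        ((((𝔭.asIdeal : FractionalIdeal (endOrder (Algebra.leftMulMatrix μ))⁰ K) / 𝔭.asIdeal :
          FractionalIdeal (endOrder (Algebra.leftMulMatrix μ))⁰ K) :
            Submodule (endOrder (Algebra.leftMulMatrix μ)) K)).spanFinrank := by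
  rw [iSup_spanFinrank_coe_div_self_eq_iSup_finrank_div_self_quotient μ hT]
  exact iSup_finrank_traceDual_quotient_add_one_eq μ hT hS

/-! ## §3 DEFINITION 4.1, `gens(𝔯) = max_I gens_𝔯(I)`, and THEOREM 4.7 ((i) versus (v)) for `T = 𝔯`:
`type(𝔯) + 1 ≤ gens(𝔯)` -/

omit [Nonempty ι] [IsFractionRing (endOrder (Algebra.leftMulMatrix μ)) K] in
/-- **DEFINITION 4.1, «`gens(S) = max{gens_S(I) : I is a fractional S-ideal}`» is a maximum: the numbers of
generators of the nonzero fractional ideals of `𝔯` are bounded by `[K:ℚ]`** (`CMOrderIdealGeneratorsCount.spanFinrank_coe_le_card`).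
[cite: Marseglia2024CMType, §4 Def. 4.1, p. 10; §2.2, p. 5] -/
theorem bddAbove_range_spanFinrank_coe :
    BddAbove (Set.range fun I : {I : FractionalIdeal (endOrder (Algebra.leftMulMatrix μ))⁰ K // I ≠ 0} ↦
      ((I : FractionalIdeal (endOrder (Algebra.leftMulMatrix μ))⁰ K) :
        Submodule (endOrder (Algebra.leftMulMatrix μ)) K).spanFinrank) := by
  refine ⟨Fintype.card ι, ?_⟩
  rintro _ ⟨I, rfl⟩
  exact spanFinrank_coe_le_card μ I.2

omit [Nonempty ι] [IsFractionRing (endOrder (Algebra.leftMulMatrix μ)) K] in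
/-- **`gens(𝔯) ≤ [K:ℚ]`.** [cite: Marseglia2024CMType, §4 Def. 4.1, p. 10; §4 Prop. 4.9 (proof: a free
`Ẑ_p`-module «of rank `≤ dim_Q(K)`»), p. 11] -/
theorem iSup_spanFinrank_coe_le_card :
    ⨆ I : {I : FractionalIdeal (endOrder (Algebra.leftMulMatrix μ))⁰ K // I ≠ 0},
        ((I : FractionalIdeal (endOrder (Algebra.leftMulMatrix μ))⁰ K) :
          Submodule (endOrder (Algebra.leftMulMatrix μ)) K).spanFinrank ≤ Fintype.card ι :=
  ciSup_le' fun I ↦ spanFinrank_coe_le_card μ I.2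

omit [Nonempty ι] [IsFractionRing (endOrder (Algebra.leftMulMatrix μ)) K] in
/-- **`gens_𝔯(I) ≤ gens(𝔯)`** for every nonzero fractional ideal `I` (DEFINITION 4.1). [cite: Marseglia2024CMType, §4
Def. 4.1, p. 10] -/
theorem spanFinrank_coe_le_iSup {I : FractionalIdeal (endOrder (Algebra.leftMulMatrix μ))⁰ K} (hI : I ≠ 0) :
    (I : Submodule (endOrder (Algebra.leftMulMatrix μ)) K).spanFinrank ≤
      ⨆ J : {J : FractionalIdeal (endOrder (Algebra.leftMulMatrix μ))⁰ K // J ≠ 0},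
        ((J : FractionalIdeal (endOrder (Algebra.leftMulMatrix μ))⁰ K) :
          Submodule (endOrder (Algebra.leftMulMatrix μ)) K).spanFinrank :=
  le_ciSup (bddAbove_range_spanFinrank_coe μ) ⟨I, hI⟩

/-- **MARSEGLIA 2024 THEOREM 4.7, (i) versus (v), for `T = 𝔯`: «`type(T) + 1 = max{gens_T((𝔭:𝔭))}` which is bounded
from above by `gens(T)`» — `type(𝔯) + 1 ≤ gens(𝔯)` for a non-maximal order `𝔯 ≠ 𝒪_K`.** [cite: Marseglia2024CMType,
§4 Thm. 4.7 ((i)⟺(v), proof), p. 11; §1 Main Theorem 2, p. 3] -/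
theorem iSup_finrank_traceDual_quotient_add_one_le_iSup_spanFinrank
    {T : FractionalIdeal (endOrder (Algebra.leftMulMatrix μ))⁰ K}
    (hT : (T : Submodule (endOrder (Algebra.leftMulMatrix μ)) K) =
      traceDual ℤ ℚ ((1 : FractionalIdeal (endOrder (Algebra.leftMulMatrix μ))⁰ K) :
        Submodule (endOrder (Algebra.leftMulMatrix μ)) K))
    (hS : ∃ a : 𝓞 K, (a : K) ∉ endOrder (Algebra.leftMulMatrix μ)) :
    (⨆ 𝔭 : MaximalSpectrum (endOrder (Algebra.leftMulMatrix μ)),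
        Module.finrank (endOrder (Algebra.leftMulMatrix μ) ⧸ 𝔭.asIdeal)
          ((T : Submodule (endOrder (Algebra.leftMulMatrix μ)) K) ⧸
            (𝔭.asIdeal • ⊤ : Submodule (endOrder (Algebra.leftMulMatrix μ))
              (T : Submodule (endOrder (Algebra.leftMulMatrix μ)) K)))) + 1 ≤
      ⨆ I : {I : FractionalIdeal (endOrder (Algebra.leftMulMatrix μ))⁰ K // I ≠ 0},
        ((I : FractionalIdeal (endOrder (Algebra.leftMulMatrix μ))⁰ K) :
          Submodule (endOrder (Algebra.leftMulMatrix μ)) K).spanFinrank := by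
  haveI := nonempty_maximalSpectrum μ
  rw [iSup_finrank_traceDual_quotient_add_one_eq_iSup_spanFinrank μ hT hS]
  exact ciSup_le fun 𝔭 ↦
    spanFinrank_coe_le_iSup μ (EndOrder.div_self_ne_zero (coeIdeal_ne_zero.2 (asIdeal_ne_bot μ 𝔭)))

/-- **`gens(𝔯) ≥ 2` for a non-maximal order** (`type(𝔯) ≥ 1`; equivalently, a non-invertible prime has a
non-principal multiplicator ring). [cite: Marseglia2024CMType, §4 Thm. 4.7 («`d` a positive integer», (v)), p. 11;
§4 Cor. 4.4 (proof: «Since `S ≠ 𝒪_K` then `gens_S(𝒪_K) ≥ 2`»), p. 10] -/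
theorem two_le_iSup_spanFinrank (hS : ∃ a : 𝓞 K, (a : K) ∉ endOrder (Algebra.leftMulMatrix μ)) :
    2 ≤ ⨆ I : {I : FractionalIdeal (endOrder (Algebra.leftMulMatrix μ))⁰ K // I ≠ 0},
        ((I : FractionalIdeal (endOrder (Algebra.leftMulMatrix μ))⁰ K) :
          Submodule (endOrder (Algebra.leftMulMatrix μ)) K).spanFinrank := by
  obtain ⟨T, -, hT⟩ := exists_coe_eq_traceDual μ (one_ne_zero' (FractionalIdeal (endOrder (Algebra.leftMulMatrix μ))⁰ K))
  exact (Nat.succ_le_succ (one_le_iSup_finrank_traceDual_quotient μ hT)).trans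
    (iSup_finrank_traceDual_quotient_add_one_le_iSup_spanFinrank μ hT hS)

end CMTypeLattice

end Literature.NumberTheory.ComplexMultiplication
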